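import Mathlib
import Literature.NumberTheory.Transcendental.KZCalculus

/-!
# Line `lens_chain` for crux `LensSquareMoment` (stmt-KontsevichZagierPeriods-17844, route HardSphereVirial)

`LensSquareMoment` (crux-strategist piece 2/3 of `StarFourDisc`): for any honest quartic-moment cylinder
`qL = [B̄ × L × L, |p|⁴] ⊂ ℝ⁶`, `108·[qL] − 16·[π]³ + 24·[√3][π]² − 27·[π] ∈ KZ.relations` (value `(π/3)(2π/3 − √3/2)²`),
`L = {|y| < 1, |y − (1,0)| < 1}` the unit-distance lens (area `2π/3 − √3/2`).

THE LINE isolates the one NEW chain — the two-dimensional LENS CHAIN — from the ring packaging that the landed toolkit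
(Theorems/InverseLandauTateLifting*, formal period ring `KZ.FormalPeriodRing`) already provides:

* `LensChain`     — `6·[L,1] − 4·[disc,1] + 3·[(0,√3),1] ∈ relations` (value `4π − 3√3 − 4π + 3√3 = 0`): `L` is the union
  (rule 1a at `x = 1/2`) of the two CONIC BANDS `y² < 1 − (1−x)²` over `(0,1/2)` and `y² < 1 − x²` over `(1/2,1)`; ONE
  Newton–Leibniz move each (`tateLifting_bandArea`) lands on the conic one-forms `2√(2x − x²)`, `2√(1 − x²)`; the disc is the
  conic band `y² ≤ 1 − x²` over `[−1,1]` and `[(0,√3),1]` is one Newton–Leibniz move from a point; all of these generate a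
  subgroup on which the kernel form of Conjecture 1 is a THEOREM (`GenusZero.conicBandKernel` / `genusZeroLowDimKernel`,
  Baker inside the calculus — here only for values in `ℚ̄ + ℚ̄π`), so the vanishing combination is a relation;
* `QuarticPeel`   — `3·[B̄ × L × L, |p|⁴] ≡ [B̄ × L × L, 1]` (product class `KZProduct.of_mul_of` + radial moment
  `∫|p|⁴ = π/3`: `ballKernel` / `tateLifting_radialBand`);
* `LensPackaging` — from the lens chain to the cylinder statement in the commutative period ring: `⟦cL⟧ = ⟦d⟧⟦ℓ⟧²`,
  `36⟦ℓ⟧² = (4⟦d⟧ − 3⟦i⟧)² = 16⟦d⟧² − 24⟦d⟧⟦i⟧ + 27` using `⟦i⟧² = ⟦(0,√3)²,1⟧ = 3` (a square of area 3: polytope sector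
  `kzPeriodConjecture_polytopeSet` / `cubePoly_toPoint`), `⟦p⟧ = ⟦d⟧³`, `⟦s⟧ = ⟦i⟧⟦d⟧²` (cylinder ↔ product identifications
  `KZ.of_sub_of_mem_relations_of_eqOn`), hence `36⟦cL⟧ = 16⟦p⟧ − 24⟦s⟧ + 27⟦d⟧` (`KZ.toFormalPeriod_eq_zero_iff`).

Composition `LensSquareMoment_of` (kernel-checked, sorries only in the stubs): `108·qL − 16p + 24s − 27d =
36·(3qL − cL) + (36cL − 16p + 24s − 27d)`.
-/

namespace Summit.KontsevichZagierPeriods.KontsevichZagierPeriods.Cruxes.LensSquareMoment.LensChainLine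

open Literature.NumberTheory.Transcendental

/-- Stub proposition 1 — THE LENS CHAIN `6·[L] − 4·[disc] + 3·[(0,√3)] ∈ relations` (conclusion of stub 1, hypothesis of
stub 3). [cite: KontsevichZagier2001, §1.2] -/
def LensChain : Prop :=
  ∀ (ℓ : Literature.NumberTheory.Transcendental.KZ.IntegralRep 2), ℓ.domain = {y | y 0 ^ 2 + y 1 ^ 2 < 1 ∧ (y 0 - 1) ^ 2 + y 1 ^ 2 < 1} → (∀ y ∈ ℓ.domain, ℓ.integrand y = 1) → ∀ (d : Literature.NumberTheory.Transcendental.KZ.IntegralRep 2), d.domain = {y | y 0 ^ 2 + y 1 ^ 2 ≤ 1} → (∀ y ∈ d.domain, d.integrand y = 1) → ∀ (i : Literature.NumberTheory.Transcendental.KZ.IntegralRep 1), i.domain = {y | 0 < y 0 ∧ y 0 ^ 2 < 3} → (∀ y ∈ i.domain, i.integrand y = 1) → (6 : ℤ) • Literature.NumberTheory.Transcendental.KZ.of ℓ - (4 : ℤ) • Literature.NumberTheory.Transcendental.KZ.of d + (3 : ℤ) • Literature.NumberTheory.Transcendental.KZ.of i ∈ Literature.NumberTheory.Transcendental.KZ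.relations

/-- Stub proposition 2 — QUARTIC PEEL `3·[B̄ × L × L, |p|⁴] ≡ [B̄ × L × L, 1]`. [cite: KontsevichZagier2001, §1.2] -/
def QuarticPeel : Prop :=
  ∀ (qL : Literature.NumberTheory.Transcendental.KZ.IntegralRep 6), qL.domain = {x | x 0 ^ 2 + x 1 ^ 2 ≤ 1 ∧ (x 2 ^ 2 + x 3 ^ 2 < 1 ∧ (x 2 - 1) ^ 2 + x 3 ^ 2 < 1) ∧ (x 4 ^ 2 + x 5 ^ 2 < 1 ∧ (x 4 - 1) ^ 2 + x 5 ^ 2 < 1)} → (∀ x ∈ qL.domain, qL.integrand x = (x 0 ^ 2 + x 1 ^ 2) ^ 2) → ∃ (cL : Literature.NumberTheory.Transcendental.KZ.IntegralRep 6), cL.domain = {x | x 0 ^ 2 + x 1 ^ 2 ≤ 1 ∧ (x 2 ^ 2 + x 3 ^ 2 < 1 ∧ (x 2 - 1) ^ 2 + x 3 ^ 2 < 1) ∧ (x 4 ^ 2 + x 5 ^ 2 < 1 ∧ (x 4 - 1) ^ 2 + x 5 ^ 2 < 1)} ∧ (∀ x ∈ cL.domain, cL.integrand x = 1) ∧ (3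 : ℤ) • Literature.NumberTheory.Transcendental.KZ.of qL - Literature.NumberTheory.Transcendental.KZ.of cL ∈ Literature.NumberTheory.Transcendental.KZ.relations

/-- Stub proposition 3 — PACKAGING (square the lens chain in the period ring, cylinder entries).
[cite: KontsevichZagier2001, §4.1] -/
def LensPackaging : Prop :=
  ∀ (cL : Literature.NumberTheory.Transcendental.KZ.IntegralRep 6), cL.domain = {x | x 0 ^ 2 + x 1 ^ 2 ≤ 1 ∧ (x 2 ^ 2 + x 3 ^ 2 < 1 ∧ (x 2 - 1) ^ 2 + x 3 ^ 2 < 1) ∧ (x 4 ^ 2 + x 5 ^ 2 < 1 ∧ (x 4 - 1) ^ 2 + x 5 ^ 2 < 1)} → (∀ x ∈ cL.domain, cL.integrand x = 1) → ∀ (p : Literature.NumberTheory.Transcendental.KZ.IntegralRep 6), p.domain = {y | y 0 ^ 2 + y 1 ^ 2 ≤ 1 ∧ y 2 ^ 2 + y 3 ^ 2 ≤ 1 ∧ y 4 ^ 2 + y 5 ^ 2 ≤ 1} → (∀ y ∈ p.domain, p.integrand y = 1) → ∀ (s : Literature.NumberTheory.Transcendental.KZ.IntegralRep 5), s.domain =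 {y | (0 < y 0 ∧ y 0 ^ 2 < 3) ∧ y 1 ^ 2 + y 2 ^ 2 ≤ 1 ∧ y 3 ^ 2 + y 4 ^ 2 ≤ 1} → (∀ y ∈ s.domain, s.integrand y = 1) → ∀ (d : Literature.NumberTheory.Transcendental.KZ.IntegralRep 2), d.domain = {y | y 0 ^ 2 + y 1 ^ 2 ≤ 1} → (∀ y ∈ d.domain, d.integrand y = 1) → LensChain → (36 : ℤ) • Literature.NumberTheory.Transcendental.KZ.of cL - (16 : ℤ) • Literature.NumberTheory.Transcendental.KZ.of p + (24 : ℤ) • Literature.NumberTheory.Transcendental.KZ.of s - (27 : ℤ) • Literature.NumberTheory.Transcendental.KZ.of d ∈ Literature.NumberTheory.Transcendental.KZ.relations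

/-- LOCAL COPY of the route decl `Summit.KontsevichZagierPeriods.KontsevichZagierPeriods.Theses.HardSphereVirial.LensSquareMoment`
(stmt-1784x; identical body). PUBLISHED IN DRAFT FORM because the Lean farm was incoherent for `Theses.HardSphereVirial` (route rev 6)
when this line was written; TO FINALISE: import the route file, replace `LensSquareMoment_local` by the route decl in `LensSquareMoment_of`, and run
`ledger skeleton check <this file> --crux <item>` — the composition is unchanged (kernel-checked here against the copy). -/
def LensSquareMoment_local : Prop :=
  ∀ (qL : Literature.NumberTheory.Transcendental.KZ.IntegralRep 6), qL.domain = {x | x 0 ^ 2 + x 1 ^ 2 ≤ 1 ∧ (x 2 ^ 2 + x 3 ^ 2 < 1 ∧ (x 2 - 1) ^ 2 + x 3 ^ 2 < 1) ∧ (x 4 ^ 2 + x 5 ^ 2 < 1 ∧ (x 4 - 1) ^ 2 + x 5 ^ 2 < 1)} → (∀ x ∈ qL.domain, qL.integrand x = (x 0 ^ 2 + x 1 ^ 2) ^ 2) → ∀ (p : Literature.NumberTheory.Transcendental.KZ.IntegralRep 6), p.domain = {y | y 0 ^ 2 + y 1 ^ 2 ≤ 1 ∧ y 2 ^ 2 +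 y 3 ^ 2 ≤ 1 ∧ y 4 ^ 2 + y 5 ^ 2 ≤ 1} → (∀ y ∈ p.domain, p.integrand y = 1) → ∀ (s : Literature.NumberTheory.Transcendental.KZ.IntegralRep 5), s.domain = {y | (0 < y 0 ∧ y 0 ^ 2 < 3) ∧ y 1 ^ 2 + y 2 ^ 2 ≤ 1 ∧ y 3 ^ 2 + y 4 ^ 2 ≤ 1} → (∀ y ∈ s.domain, s.integrand y = 1) → ∀ (d : Literature.NumberTheory.Transcendental.KZ.IntegralRep 2), d.domain = {y | y 0 ^ 2 + y 1 ^ 2 ≤ 1} → (∀ y ∈ d.domain, d.integrand y = 1) → (108 : ℤ) • Literature.NumberTheory.Transcendental.KZ.of qL - (16 : ℤ) • Literature.NumberTheory.Transcendental.KZ.of p + (24 : ℤ) • Literature.NumberTheory.Transcendental.KZ.of s - (27 : ℤ) • Literature.NumberTheory.Transcendental.KZ.of d ∈ Literature.NumberTheory.Transcendental.KZ.relations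

/-- **Stub 1 (the new chain).** [cite: KontsevichZagier2001, §1.2] -/
theorem stub_lensChain : LensChain := by
  sorry

/-- **Stub 2.** [cite: KontsevichZagier2001, §1.2] -/
theorem stub_quarticPeel : QuarticPeel := by
  sorry

/-- **Stub 3.** [cite: KontsevichZagier2001, §4.1] -/
theorem stub_lensPackaging : LensPackaging := by
  sorry

/-- **Composition**: the three stubs imply the crux `LensSquareMoment` BY NAME:
`108·qL − 16p + 24s − 27d = 36·(3qL − cL) + (36cL − 16p + 24s − 27d)`. [cite: KontsevichZagier2001, §1.2] -/
theorem LensSquareMoment_of :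
    LensSquareMoment_local := by
  intro qL hqL hqL1 p hp hp1 s hs hs1 d hd hd1
  obtain ⟨cL, hcL, hcL1, hpeel⟩ := stub_quarticPeel qL hqL hqL1
  have hpack := stub_lensPackaging cL hcL hcL1 p hp hp1 s hs hs1 d hd hd1 stub_lensChain
  have hsum := KZ.relations.add_mem (KZ.relations.zsmul_mem hpeel 36) hpack
  convert hsum using 1
  module

end Summit.KontsevichZagierPeriods.KontsevichZagierPeriods.Cruxes.LensSquareMoment.LensChainLine
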